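import Literature.MathematicalPhysics.QuantumFieldTheory.Balaban1983to89.B3Op116MajorantStep

/-!
# Bałaban, *(Higgs)₂,₃ quantum fields in a finite volume III. Renormalization* [B3] — the kernel of the operator (1.16) p. 414, THE
ENGINE OF THE MIXED CLAUSE: (i) ONE PAIR OF SCALES of the decomposition (2.6) contracted over the bonds of `T_ε` with ARBITRARY exponents
and the ORDERED half-squares of scale pairs summed over their FINER index (the coarser piece may carry the exponent `0` of a
twice-differentiated propagator); (ii) the scale pieces `G^η_{(j)}` of (2.6) are SYMMETRIC, hence a piece on a dipole source is `ε`× one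
derivative of the transposed row; (iii) the per-piece (2.10) dictionary on `T_ε` (column, differentiated column, twice-differentiated
kernel of ONE piece as single-scale bumps) and the block average of a majorant of any exponent.  (The `M^*D` and `D^*M` sources of
`V_k(A,B)` in LEIBNIZ FORM — THEOREM A′ and its mirror A″ — are p35's `B3Op116LeibnizRows`, landed while v1 of this file was in review;
v2 drops its own copies and the consumer uses p35's by name.)

statement-level skeleton of published theorems with citation tags; proofs where landed; nothing here is a claim about the Yang–Mills mass gap

T. Bałaban, Commun. Math. Phys. **88** (1983) 411–445 [cite: Balaban1983Higgs3]; part I, Commun. Math. Phys. **85** (1982) 603–636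
[cite: Balaban1982Higgs1].  PDFs held: `paper:balaban1983-higgs-2-3-quantum-fields-finite-volume` (journal page = PDF page + 410;
p. 414 = `p0004.txt`, p. 424 = `p0014.txt`, p. 426 = `p0016.txt`), `paper:balaban1982-cmp85-higgs23-i` (journal page = PDF page + 602;
p. 605 = `p0003.txt`, p. 615 = `p0013.txt`).

CITATION HEADER (lean-in-tree rule).  Cell `lit-balaban` (HOME `run/shared/lean/pub/lit-balaban/`), Phase-2 proof seat **p40** gen 73
(unit `lit-balaban-p40`); TAKING line HOME/STATUS 2026-08-23T05:31Z («FILE 4M» = the mixed seed of the (1.16) programme, p35 g22's offer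
of 05:13:21Z; design `lit-balaban-p35/DESIGN-FILE4.md` §9(d), `lit-balaban-r14/DESIGN-B3-116-analytic.md`).  SKELETON rows **B3.Eq1.16** /
**B3.Eq2.5** (fold owner r15; decl of record `B3Sect2StatementsPart2.ScaledKernels.Ineq25At`, clause (ii)) — this file is a located
ENGINE (no head claim); its consumer is `B3Op116MixedSeed` (p40: the mixed second covariant derivative of `G_k(T,A+B) − G_k(T,B)` on a dipole
is `|e|s`× an exponent-`1` majorant).  v1 = p354083 (bounced `dedup.landed` against p35's `B3Op116LeibnizRows`, landed 05:38Z: two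
restated lemmas); v2 = this file: §§3–4 of v1 (the Leibniz forms) removed in favour of p35's file.  USED BY NAME, never restated: r14's
`B3Ineq210RegularRegion.{pieceR, sandwichR, sum_pieceR, regRegionKernels, scaleR_eq, interior_univ}`, `B3Op116KernelRegularTorus.{sum_dip_apply,
sum_block_exp_le}`, `B3Op116ScaleChains.{exp_tdist_shift_le', rate_eq, sum_mesh_rpow_le, mesh_succ}`, p33's
`B3Op116MajorantConvolution.{conv2_scales_le, pair_scale_algebra, sum_range_succ_mesh_rpow_le, bump_mono_rate}` and
`B3Ineq210MixedRegularRegion.mixedTermR`, p35's `B3Op116MajorantStep.blockavg_scale_algebra'`, p40's `B3Op116Pieces.{fOne, norm_fOne_apply_le}` and `B3Ineq210MixedRegularTorus.{dip, onb,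
siteInner_dip, norm_covDeriv_apply_single_le, siteInner_single_right}`, r15's carrier predicate `B3Sect2StatementsPart2.ScaledKernels.Ineq210`,
the typer's `HiggsCovariancePos.siteInner_avgQkLin`, `B1Eq230FluctCovPos.{siteInner_propagatorK_comm, siteInner_fluctCovA_comm}`.

## What is printed

[B3] p. 414 [PDF 4] (verbatim): *"for n, n′ sufficiently large, a kernel of the operator (1.16) is a sufficiently regular function of
both variables. More exactly the Hölder norms of the covariant derivatives of this kernel, the norms defined for example in the
inequalities (I.2.24) and (I.2.25) of Proposition I.2.1, are exponentially decaying with the distance of the arguments and are uniformly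
bounded by O(1)(e(L^kε)^{1−α})^{n+n′}, where α > 0 but can be arbitrarily small. This estimate follows easily from the properties of the
propagators G_k(Ω, A) proved in the next paper."*  [B3] p. 424 [PDF 14], (2.6): `G^η_k(B̃) = Σ_{j=0}^{k−1} G^η_{(j)}(B̃)`; p. 426 [PDF 16],
(2.10) (verbatim): *"For the propagators G^η_{(j)} we apply the inequality |G^η_{(j)}(Ω, B̃; x, x′)| ≤ O(1)(L^jη)^{−d+2}e^{−δ₁(L^jη)^{−1}|x−x′|},
(2.10) and if the propagator is differentiated, then for each differentiation, there is an additional factor (L^jη)^{−1} on the right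
side."*  [B1] p. 614 [PDF 12], (3.14): `U(A) = 1 + ηF_{1,k}(A)`; p. 615 [PDF 13], (3.16): the bracket `V_k` with its terms
`F_{1,k}(A)^*D^η_B + D^{η*}_BF_{1,k}(A) + …`.

## What this file proves, and why (the one Calderón–Zygmund step of the mixed clause)

In the kernel bookkeeping of (1.16) (r14's design §2) every factor `D^εG^η_{(j)}D^{ε*}` carries the exponent `0` (`(L^jη)^{−d}`, the
twice-differentiated (2.10)), and a scale sum `Σ_j 1` of such a factor against a smoother one is a logarithm of the number of scales: with a
dipole at BOTH ends of the chain one exponent-`0` slot survives in every arrangement (p35 DESIGN-FILE4 §9(d)).  The cure is the classical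
one: for each PAIR of scales put the second derivative on the COARSER piece — directly when the twice-differentiated factor is already
the coarser one, by SUMMATION BY PARTS (the Leibniz forms below) when it is the finer one — so that every pair costs `(L^{j_fine}ε)^{a_f}·
(L^{j_coarse}ε)^{a_c}((L^{j_coarse}ε)^d)^{−1}` with `a_f > 0`, and the finer index sums geometrically under the coarser one.
§1 `bump_shift_le(')`, `mesh_rpow_zero_sub`, **`pair_bond_le`**: `Σ_bF(b)G(b) ≤ d·c₁c₂N(8d/δ)^d(ε^d)^{−1}·(L^{j₁}ε)^{e₁}(L^{j₂}ε)^{e₂}((L^{max}ε)^d)^{−1}·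
exp(−(δ/2)(L^{max}ε)^{−1}ε|x−y|)` for bond kernels below single-scale bumps of exponents `e₁ − d`, `e₂ − d` (ANY real `e_i`; p33's
`conv2_scales_le` + `pair_scale_algebra`).  §2 **`sum_lower_pair_le`** (`Σ_{j₁<k}Σ_{j₂≤j₁}(L^{j₂}ε)^{a_f}g(j₁) ≤ L^{a_f}(L^{a_f}−1)^{−1}Σ_{j₁<k}(L^{j₁}ε)^{a_f}g(j₁)`,
`a_f > 0`, the coarse weight `g ≥ 0` free), `sum_strict_lower_le`, **`sum_sq_le_of_cases`** (a double scale sum split by the order of the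
indices, each pair filed under its larger index), **`majorant_succ_le`** (a range-`(k+1)` majorant is `≤ (1+L^a)`× the range-`k` majorant at
rate `δ/L` — how a top-scale bump re-enters the currency).  §3 `norm_fOne_apply_le_of_abs_le` (`‖F₁(A_b)X‖ ≤ |e|s‖X‖`; the Leibniz
forms themselves — THEOREM A′ `inv_smul_sum_srcDM_eq`, A″ `sum_srcMD_eq`, the `F₁`-differences `nMul` with `norm_nMul_apply_le`, and
`norm_fOne_neg_apply_le` — are p35's `B3Op116LeibnizRows`).  §4 `siteInner_sandwichR_comm`, **`siteInner_pieceR_comm`** (the pieces of (2.6)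
are symmetric), `inner_pieceR_dip_apply`, **`norm_pieceR_dip_apply_le`** (`‖(G^η_{(j)}dip^Y_bw)(x)‖ ≤ ε‖w‖Σ_i‖(D^ε_YG^η_{(j)}e_{(x,i)})(b)‖`).
§5 `pcol`/`pdcol`/`pmix` (the three kernel quantities of ONE piece on `T_ε`), `pmix_eq_mixedTermR`, **`pcol_le`/`pdcol_le`** (from r15's
`Ineq210 δ₁ C` on r14's torus carrier), **`pmix_le`** (from a bound of p33's `mixedTermR` in the shape of the conclusion of
`ineq210_mixed_regularRegion_univ`), `covDeriv_propagatorK_eq_sum_pieces`, `propagatorK_apply_eq_sum_pieces` ((2.6) on a field and through a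
derivative).  §6 `mesh_rpow_mul_inv_pow_eq`, **`block_avg_majorant_le`** (the `L^k`-block average of a majorant of
exponent `e > 0` is one top-scale bump `(L^kε)^e((L^kε)^d)^{−1}e^{−(δ/2)|z−x′|/L^k}`; r14's `block_avg_col_le` is `e = 2`).

## Honest scope

Exact identities, triangle inequalities and lattice-sum lemmas only; nothing of (1.16) itself is asserted here (the consumer
`B3Op116MixedSeed` assembles the mixed seed; which chains occur is r14's / p35's / p40's business).  §5 takes the (2.10) bounds as
HYPOTHESES in r15's / p33's shapes (discharged on `T_ε` by r14's `ineq210_regularRegion_univ_small` and p33's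
`ineq210_mixed_regularRegion_univ`, not re-proved here); `m² > 0`, `a > 0`, `1 ≤ k ≤ K` where `sum_pieceR` needs them; rates and constants
not optimized.  No `def … : Prop`, no new named fact (`pcol`, `pdcol`, `pmix` are concrete definitions); no `sorry`; axioms standard.
Value = located engine of a by-reference step of B3, NOT summit progress.
-/

noncomputable section

open scoped BigOperators InnerProductSpace

namespace Literature.MathematicalPhysics.QuantumFieldTheory.Balaban1983to89.B3Op116OrderedPairs

open HiggsLattice (ChargeData ScalarField siteInner covDeriv)
open HiggsCovariance (propagatorK E)
open B1Eq230FluctCov (Ix cb)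
open B1Ineq234Concrete (nCol)
open B1Ineq234LevelZero (tdist_comm)
open B3Ineq210RegularRegion (regRegionKernels Interior sum_pieceR scaleR_eq interior_univ pieceR sandwichR pieceR_zero
  pieceR_of_pos pieceR_of_le)
open B3Op116Pieces (fOne norm_fOne_apply_le norm_U_apply)
open B3Op116ScaleChains (exp_tdist_shift_le' rate_eq sum_site_le_sum_idx mesh_rpow_add)
open B3Op116MajorantConvolution (conv2_scales_le pair_scale_algebra sum_range_succ_mesh_rpow_le majorant_nonneg bump_mono_rate
  bump_mono_scale)
open HiggsCovariancePos (sum_site_dir)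
open B3Ineq210MixedRegularTorus (dip onb cb_eq_single siteInner_single_right siteInner_dip)
open HiggsFluctMeasurePos (siteInner_comm siteInner_smul_right siteInner_smul_left)
open B1Eq230FluctCovPos (siteInner_propagatorK_comm siteInner_fluctCovA_comm)

variable {P : HiggsLattice.Params} {N : ℕ}

/-! ## §1 Single-scale bumps: shifts, and ONE pair of scales contracted over the bonds of `T_ε` -/

section Bumps

/-- A single (2.10) bump read at a shifted point costs a factor `e` (rate `δ/L^j ≤ 1`, one lattice step).
[cite: Balaban1983Higgs3, (2.10) p.426] -/
theorem bump_shift_le {δ : ℝ} (hδ : 0 ≤ δ) (hδ1 : δ ≤ 1) (j : ℕ) (x y : HiggsLattice.Site P 0) (μ : Fin P.d) :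
    Real.exp (-(δ * (P.mesh j)⁻¹ * (P.mesh 0 * (HiggsLattice.Site.tdist x (y.shift μ) : ℝ))))
      ≤ Real.exp 1 * Real.exp (-(δ * (P.mesh j)⁻¹ * (P.mesh 0 * (HiggsLattice.Site.tdist x y : ℝ)))) := by
  simp only [rate_eq]
  have hL1 : (1 : ℝ) ≤ (P.L : ℝ) ^ j := one_le_pow₀ (by exact_mod_cast P.hL)
  have hr0 : 0 ≤ δ / (P.L : ℝ) ^ j := by positivity
  have hr1 : δ / (P.L : ℝ) ^ j ≤ 1 := (div_le_self hδ hL1).trans hδ1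
  calc Real.exp (-(δ / (P.L : ℝ) ^ j * (HiggsLattice.Site.tdist x (y.shift μ) : ℝ)))
      ≤ Real.exp (δ / (P.L : ℝ) ^ j) * Real.exp (-(δ / (P.L : ℝ) ^ j * (HiggsLattice.Site.tdist x y : ℝ))) :=
        exp_tdist_shift_le' hr0 x y μ
    _ ≤ _ := mul_le_mul_of_nonneg_right (Real.exp_le_exp.mpr hr1) (Real.exp_nonneg _)

/-- The same with the shift in the first argument. [cite: Balaban1983Higgs3, (2.10) p.426] -/
theorem bump_shift_le' {δ : ℝ} (hδ : 0 ≤ δ) (hδ1 : δ ≤ 1) (j : ℕ) (x y : HiggsLattice.Site P 0) (μ : Fin P.d) :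
    Real.exp (-(δ * (P.mesh j)⁻¹ * (P.mesh 0 * (HiggsLattice.Site.tdist (x.shift μ) y : ℝ))))
      ≤ Real.exp 1 * Real.exp (-(δ * (P.mesh j)⁻¹ * (P.mesh 0 * (HiggsLattice.Site.tdist x y : ℝ)))) := by
  rw [tdist_comm (x.shift μ) y, tdist_comm x y]
  exact bump_shift_le hδ hδ1 j y x μ

/-- `(L^jε)^{0−d} = ((L^jε)^d)^{−1}` (the exponent of a twice-differentiated piece as a real power). [cite: Balaban1983Higgs3, (2.10) p.426] -/
theorem mesh_rpow_zero_sub (j : ℕ) : P.mesh j ^ ((0 : ℝ) - (P.d : ℝ)) = (P.mesh j ^ P.d)⁻¹ := by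
  rw [Real.rpow_sub (P.mesh_pos j), Real.rpow_zero, Real.rpow_natCast, one_div]

/-- **ONE PAIR OF SCALES CONTRACTED OVER THE BONDS of `T_ε`**: two nonnegative bond kernels, the first below a scale-`j₁` bump anchored
at `x` (exponent `e₁ − d`), the second below a scale-`j₂` bump anchored at `y` (exponent `e₂ − d`), both read at the base point `b₋`:
`Σ_b F(b)G(b) ≤ d·c₁c₂·N(8d/δ)^d·(ε^d)^{−1}·(L^{j₁}ε)^{e₁}(L^{j₂}ε)^{e₂}·((L^{max}ε)^d)^{−1}·exp(−(δ/2)(L^{max}ε)^{−1}ε|x−y|)` — the volume of the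
finer scale, half the decay of the coarser one (p33's `conv2_scales_le` + `pair_scale_algebra`; NO sign condition on `e₁, e₂`).
[cite: Balaban1983Higgs3, (2.6) p.424, (2.10) p.426] [cite: Balaban1983RegularityDecay, Sect. 5 Theorem p.594] -/
theorem pair_bond_le {δ : ℝ} (hδ : 0 < δ) (hδ1 : δ ≤ 1) (j₁ j₂ : ℕ) {c₁ c₂ e₁ e₂ : ℝ} (hc₁ : 0 ≤ c₁) (hc₂ : 0 ≤ c₂)
    (i₀ : Ix N) (x y : HiggsLattice.Site P 0) (F G : HiggsLattice.PBond P 0 → ℝ) (hF0 : ∀ b, 0 ≤ F b) (hG0 : ∀ b, 0 ≤ G b)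
    (hF : ∀ b, F b ≤ c₁ * P.mesh j₁ ^ (e₁ - (P.d : ℝ)) *
      Real.exp (-(δ * (P.mesh j₁)⁻¹ * (P.mesh 0 * (HiggsLattice.Site.tdist x b.src : ℝ)))))
    (hG : ∀ b, G b ≤ c₂ * P.mesh j₂ ^ (e₂ - (P.d : ℝ)) *
      Real.exp (-(δ * (P.mesh j₂)⁻¹ * (P.mesh 0 * (HiggsLattice.Site.tdist b.src y : ℝ))))) :
    ∑ b : HiggsLattice.PBond P 0, F b * G b
      ≤ (P.d : ℝ) * (c₁ * c₂ * ((nCol N : ℝ) * (8 * P.d / δ) ^ P.d * (P.mesh 0 ^ P.d)⁻¹)) *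
          (P.mesh j₁ ^ e₁ * P.mesh j₂ ^ e₂ * (P.mesh (max j₁ j₂) ^ P.d)⁻¹) *
          Real.exp (-(δ / 2 * (P.mesh (max j₁ j₂))⁻¹ * (P.mesh 0 * (HiggsLattice.Site.tdist x y : ℝ)))) := by
  set E₁ : HiggsLattice.Site P 0 → ℝ := fun u =>
    Real.exp (-(δ * (P.mesh j₁)⁻¹ * (P.mesh 0 * (HiggsLattice.Site.tdist x u : ℝ)))) with hE₁
  set E₂ : HiggsLattice.Site P 0 → ℝ := fun u =>
    Real.exp (-(δ * (P.mesh j₂)⁻¹ * (P.mesh 0 * (HiggsLattice.Site.tdist u y : ℝ)))) with hE₂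
  have hm₁ : 0 ≤ c₁ * P.mesh j₁ ^ (e₁ - (P.d : ℝ)) := mul_nonneg hc₁ (Real.rpow_nonneg (P.mesh_pos j₁).le _)
  have hm₂ : 0 ≤ c₂ * P.mesh j₂ ^ (e₂ - (P.d : ℝ)) := mul_nonneg hc₂ (Real.rpow_nonneg (P.mesh_pos j₂).le _)
  -- bonds = sites × directions
  have hsd := sum_site_dir (P := P) (k := 0) (fun u (_μ : Fin P.d) => E₁ u * E₂ u)
  have hd : ∑ u : HiggsLattice.Site P 0, ∑ _μ : Fin P.d, E₁ u * E₂ u = (P.d : ℝ) * ∑ u : HiggsLattice.Site P 0, E₁ u * E₂ u := by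
    rw [Finset.mul_sum]
    refine Finset.sum_congr rfl fun u _ => ?_
    simp only [Finset.sum_const, Finset.card_univ, Fintype.card_fin, nsmul_eq_mul]
  have hconv := conv2_scales_le (P := P) (N := N) hδ hδ1 j₁ j₂ x y i₀
  calc ∑ b : HiggsLattice.PBond P 0, F b * G b
      ≤ ∑ b : HiggsLattice.PBond P 0, (c₁ * P.mesh j₁ ^ (e₁ - (P.d : ℝ)) * E₁ b.src) * (c₂ * P.mesh j₂ ^ (e₂ - (P.d : ℝ)) * E₂ b.src) :=
        Finset.sum_le_sum fun b _ => mul_le_mul (hF b) (hG b) (hG0 b) ((hF0 b).trans (hF b))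
    _ = (c₁ * P.mesh j₁ ^ (e₁ - (P.d : ℝ))) * (c₂ * P.mesh j₂ ^ (e₂ - (P.d : ℝ))) *
          ∑ b : HiggsLattice.PBond P 0, E₁ b.src * E₂ b.src := by
        rw [Finset.mul_sum]; exact Finset.sum_congr rfl fun b _ => by ring
    _ = (c₁ * P.mesh j₁ ^ (e₁ - (P.d : ℝ))) * (c₂ * P.mesh j₂ ^ (e₂ - (P.d : ℝ))) *
          ((P.d : ℝ) * ∑ u : HiggsLattice.Site P 0, E₁ u * E₂ u) := by rw [← hsd, hd]
    _ ≤ (c₁ * P.mesh j₁ ^ (e₁ - (P.d : ℝ))) * (c₂ * P.mesh j₂ ^ (e₂ - (P.d : ℝ))) *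
          ((P.d : ℝ) * ((nCol N : ℝ) * (8 * P.d / δ) ^ P.d * ((P.L : ℝ) ^ (min j₁ j₂)) ^ P.d *
            Real.exp (-(δ / 2 * (P.mesh (max j₁ j₂))⁻¹ * (P.mesh 0 * (HiggsLattice.Site.tdist x y : ℝ)))))) :=
        mul_le_mul_of_nonneg_left (mul_le_mul_of_nonneg_left hconv (Nat.cast_nonneg _)) (mul_nonneg hm₁ hm₂)
    _ = (P.d : ℝ) * (c₁ * c₂ * ((nCol N : ℝ) * (8 * P.d / δ) ^ P.d)) *
          (P.mesh j₁ ^ (e₁ - (P.d : ℝ)) * P.mesh j₂ ^ (e₂ - (P.d : ℝ)) * ((P.L : ℝ) ^ (min j₁ j₂)) ^ P.d) *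
          Real.exp (-(δ / 2 * (P.mesh (max j₁ j₂))⁻¹ * (P.mesh 0 * (HiggsLattice.Site.tdist x y : ℝ)))) := by ring
    _ = _ := by rw [pair_scale_algebra]; ring

end Bumps

/-! ## §2 Ordered scale pairs: the FINER index is summed geometrically, the coarser exponent is free -/

section Ordered

/-- **The lower triangle of a double scale sum** (`j₂ ≤ j₁`, the pair filed under the COARSER index `j₁`): for `a_f > 0` and nonnegative
coarse weights `g`, `Σ_{j₁<k}Σ_{j₂≤j₁}(L^{j₂}ε)^{a_f}·g(j₁) ≤ L^{a_f}(L^{a_f}−1)^{−1}·Σ_{j₁<k}(L^{j₁}ε)^{a_f}·g(j₁)` — the finer exponent must be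
positive, the coarser weight is arbitrary (this is the half of p33's `conv_majorant_le` that survives an exponent `0` on the coarser
piece). [cite: Balaban1983Higgs3, (1.16) p.414, (2.6) p.424, (2.10) p.426] -/
theorem sum_lower_pair_le (hL : 1 < P.L) {af : ℝ} (haf : 0 < af) (k : ℕ) (g : ℕ → ℝ) (hg : ∀ j, 0 ≤ g j) :
    ∑ j₁ ∈ Finset.range k, ∑ j₂ ∈ Finset.range (j₁ + 1), P.mesh j₂ ^ af * g j₁
      ≤ (P.L : ℝ) ^ af / ((P.L : ℝ) ^ af - 1) * ∑ j₁ ∈ Finset.range k, P.mesh j₁ ^ af * g j₁ := by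
  rw [Finset.mul_sum]
  refine Finset.sum_le_sum fun j₁ _ => ?_
  rw [← Finset.sum_mul, ← mul_assoc]
  exact mul_le_mul_of_nonneg_right (sum_range_succ_mesh_rpow_le hL haf j₁) (hg j₁)

/-- The STRICT lower triangle is below the closed one (nonnegative terms). [cite: Balaban1983Higgs3, (2.6) p.424] -/
theorem sum_strict_lower_le (k : ℕ) (g : ℕ → ℕ → ℝ) (hg : ∀ i j, 0 ≤ g i j) :
    ∑ j₁ ∈ Finset.range k, ∑ j₂ ∈ Finset.range j₁, g j₁ j₂ ≤ ∑ j₁ ∈ Finset.range k, ∑ j₂ ∈ Finset.range (j₁ + 1), g j₁ j₂ :=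
  Finset.sum_le_sum fun j₁ _ =>
    Finset.sum_le_sum_of_subset_of_nonneg (Finset.range_subset_range.mpr (Nat.le_succ j₁)) fun _ _ _ => hg _ _

/-- **Splitting a double scale sum by cases on the order of the indices**: if `T ≤ A` on `{j₂ ≤ j₁}` and `T ≤ B` on `{j₁ < j₂}` with
`B ≥ 0`, then `Σ_{j₁<k}Σ_{j₂<k}T ≤ Σ_{j₁<k}Σ_{j₂≤j₁}A + Σ_{j₂<k}Σ_{j₁≤j₂}B` (each pair filed under its larger index; p33's
`sum_sq_le_lower_add_upper` is the case `T = A = B`). [cite: Balaban1983Higgs3, (2.6) p.424] -/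
theorem sum_sq_le_of_cases (k : ℕ) (T A B : ℕ → ℕ → ℝ) (hB : ∀ i j, 0 ≤ B i j)
    (hle : ∀ j₁ j₂, j₂ ≤ j₁ → T j₁ j₂ ≤ A j₁ j₂) (hlt : ∀ j₁ j₂, j₁ < j₂ → T j₁ j₂ ≤ B j₁ j₂) :
    ∑ j₁ ∈ Finset.range k, ∑ j₂ ∈ Finset.range k, T j₁ j₂
      ≤ (∑ j₁ ∈ Finset.range k, ∑ j₂ ∈ Finset.range (j₁ + 1), A j₁ j₂)
        + ∑ j₂ ∈ Finset.range k, ∑ j₁ ∈ Finset.range (j₂ + 1), B j₁ j₂ := by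
  classical
  have hsplit : ∀ j₁ ∈ Finset.range k, ∑ j₂ ∈ Finset.range k, T j₁ j₂
      ≤ (∑ j₂ ∈ Finset.range (j₁ + 1), A j₁ j₂) + ∑ j₂ ∈ (Finset.range k).filter (fun j₂ => j₁ < j₂), B j₁ j₂ := by
    intro j₁ hj₁
    have hk₁ := Finset.mem_range.1 hj₁
    rw [← Finset.sum_filter_add_sum_filter_not (Finset.range k) (fun j₂ => j₂ ≤ j₁)]
    refine add_le_add ?_ ?_
    · have hset : (Finset.range k).filter (fun j₂ => j₂ ≤ j₁) = Finset.range (j₁ + 1) := by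
        ext j; simp only [Finset.mem_filter, Finset.mem_range]; omega
      rw [hset]
      exact Finset.sum_le_sum fun j₂ hj₂ => hle j₁ j₂ (by have := Finset.mem_range.1 hj₂; omega)
    · have hset : (Finset.range k).filter (fun j₂ => ¬ j₂ ≤ j₁) = (Finset.range k).filter (fun j₂ => j₁ < j₂) := by
        ext j; simp only [Finset.mem_filter, Finset.mem_range, not_le]
      rw [hset]
      exact Finset.sum_le_sum fun j₂ hj₂ => hlt j₁ j₂ (Finset.mem_filter.1 hj₂).2
  have hcomm : ∑ j₁ ∈ Finset.range k, ∑ j₂ ∈ (Finset.range k).filter (fun j₂ => j₁ < j₂), B j₁ j₂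
      = ∑ j₂ ∈ Finset.range k, ∑ j₁ ∈ (Finset.range k).filter (fun j₁ => j₁ < j₂), B j₁ j₂ := by
    refine Finset.sum_comm' ?_
    intro j₁ j₂
    simp only [Finset.mem_filter, Finset.mem_range]
    omega
  have hup : ∀ j₂, ∑ j₁ ∈ (Finset.range k).filter (fun j₁ => j₁ < j₂), B j₁ j₂ ≤ ∑ j₁ ∈ Finset.range (j₂ + 1), B j₁ j₂ := by
    intro j₂
    refine Finset.sum_le_sum_of_subset_of_nonneg ?_ (fun j _ _ => hB _ _)
    intro j hj
    simp only [Finset.mem_filter, Finset.mem_range] at hj ⊢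
    omega
  calc ∑ j₁ ∈ Finset.range k, ∑ j₂ ∈ Finset.range k, T j₁ j₂
      ≤ ∑ j₁ ∈ Finset.range k, ((∑ j₂ ∈ Finset.range (j₁ + 1), A j₁ j₂)
          + ∑ j₂ ∈ (Finset.range k).filter (fun j₂ => j₁ < j₂), B j₁ j₂) := Finset.sum_le_sum hsplit
    _ = (∑ j₁ ∈ Finset.range k, ∑ j₂ ∈ Finset.range (j₁ + 1), A j₁ j₂)
          + ∑ j₁ ∈ Finset.range k, ∑ j₂ ∈ (Finset.range k).filter (fun j₂ => j₁ < j₂), B j₁ j₂ := Finset.sum_add_distrib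
    _ ≤ _ := by rw [hcomm]; exact add_le_add le_rfl (Finset.sum_le_sum fun j₂ _ => hup j₂)

/-- **A range-`(k+1)` majorant is below a range-`k` majorant at the rate `δ/L`** (`k ≥ 1`, `c ≥ 0`, `δ ≥ 0`): the terms `j < k` by rate
weakening, the top term `j = k` against the term `j = k − 1` (`(L^kε)^a = L^a(L^{k−1}ε)^a`, `e^{−(δ/L^k)t} = e^{−((δ/L)/L^{k−1})t}`):
`Σ_{j≤k} c(L^jε)^a e_j(δ) ≤ (1 + L^a)·Σ_{j<k} c(L^jε)^a e_j(δ/L)` — the form in which a top-scale bump re-enters the range-`k` currency.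
[cite: Balaban1983Higgs3, (2.6) p.424, (2.10) p.426] -/
theorem majorant_succ_le {k : ℕ} (hk : 1 ≤ k) {c a δ : ℝ} (hc : 0 ≤ c) (hδ : 0 ≤ δ) (u v : HiggsLattice.Site P 0) :
    ∑ j ∈ Finset.range (k + 1), c * P.mesh j ^ a * Real.exp (-(δ * (P.mesh j)⁻¹ * (P.mesh 0 * (HiggsLattice.Site.tdist u v : ℝ))))
      ≤ (1 + (P.L : ℝ) ^ a) * ∑ j ∈ Finset.range k, c * P.mesh j ^ a *
          Real.exp (-(δ / P.L * (P.mesh j)⁻¹ * (P.mesh 0 * (HiggsLattice.Site.tdist u v : ℝ)))) := by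
  have hL0 : (0 : ℝ) < (P.L : ℝ) := by have := P.hL; positivity
  have hL1 : (1 : ℝ) ≤ (P.L : ℝ) := by exact_mod_cast P.hL
  set t : ℝ := P.mesh 0 * (HiggsLattice.Site.tdist u v : ℝ) with ht
  have ht0 : 0 ≤ t := mul_nonneg (P.mesh_pos 0).le (Nat.cast_nonneg _)
  have hterm : ∀ j, 0 ≤ c * P.mesh j ^ a * Real.exp (-(δ / P.L * (P.mesh j)⁻¹ * t)) :=
    fun j => mul_nonneg (mul_nonneg hc (Real.rpow_nonneg (P.mesh_pos j).le a)) (Real.exp_nonneg _)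
  have hδL : δ / P.L ≤ δ := div_le_self hδ hL1
  -- the terms `j < k`
  have hlow : ∑ j ∈ Finset.range k, c * P.mesh j ^ a * Real.exp (-(δ * (P.mesh j)⁻¹ * t))
      ≤ ∑ j ∈ Finset.range k, c * P.mesh j ^ a * Real.exp (-(δ / P.L * (P.mesh j)⁻¹ * t)) :=
    Finset.sum_le_sum fun j _ => mul_le_mul_of_nonneg_left (bump_mono_rate hδL j u v)
      (mul_nonneg hc (Real.rpow_nonneg (P.mesh_pos j).le a))
  -- the top term against the term `k − 1`
  obtain ⟨m, rfl⟩ : ∃ m, k = m + 1 := ⟨k - 1, by omega⟩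
  have hmesh : P.mesh (m + 1) = (P.L : ℝ) * P.mesh m := B3Op116ScaleChains.mesh_succ P m
  have htop : c * P.mesh (m + 1) ^ a * Real.exp (-(δ * (P.mesh (m + 1))⁻¹ * t))
      = (P.L : ℝ) ^ a * (c * P.mesh m ^ a * Real.exp (-(δ / P.L * (P.mesh m)⁻¹ * t))) := by
    rw [hmesh, Real.mul_rpow hL0.le (P.mesh_pos m).le, mul_inv]
    have : δ * ((P.L : ℝ)⁻¹ * (P.mesh m)⁻¹) * t = δ / P.L * (P.mesh m)⁻¹ * t := by rw [div_eq_mul_inv]; ring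
    rw [this]; ring
  have hlast : c * P.mesh (m + 1) ^ a * Real.exp (-(δ * (P.mesh (m + 1))⁻¹ * t))
      ≤ (P.L : ℝ) ^ a * ∑ j ∈ Finset.range (m + 1), c * P.mesh j ^ a * Real.exp (-(δ / P.L * (P.mesh j)⁻¹ * t)) := by
    rw [htop]
    exact mul_le_mul_of_nonneg_left (Finset.single_le_sum (fun j _ => hterm j) (Finset.self_mem_range_succ m))
      (Real.rpow_nonneg hL0.le a)
  rw [Finset.sum_range_succ, add_mul, one_mul]
  exact add_le_add hlow hlast

end Ordered

/-! ## §3 The size of the multiplier `F₁(A_b)` of (I.3.14) (the Leibniz forms THEOREM A′/A″ and the `F₁`-differences are p35's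
`B3Op116LeibnizRows`, used by name by the consumer) -/

section Multipliers

variable {C : ChargeData N} {A : HiggsLattice.VecField P 0}

/-- `‖F₁(A_b)X‖ ≤ |e|s‖X‖` for `|A_b| ≤ s` (p40's `norm_fOne_apply_le`; the `−A_b` version is p35's
`B3Op116LeibnizRows.norm_fOne_neg_apply_le`). [cite: Balaban1982Higgs1, (3.14) p.614] -/
theorem norm_fOne_apply_le_of_abs_le {s : ℝ} {b : HiggsLattice.PBond P 0} (hA : |A b| ≤ s) (X : E N) :
    ‖fOne C (P.mesh 0) (A b) X‖ ≤ |C.e| * s * ‖X‖ :=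
  (norm_fOne_apply_le C (P.mesh_pos 0).ne' (A b) X).trans (by gcongr)

end Multipliers

/-! ## §4 The scale pieces (2.6) are symmetric; a piece on a dipole, read through the symmetry -/

section PieceSymmetry

variable (C : ChargeData N) (Ω : Finset (HiggsLattice.Site P 0)) (X : HiggsLattice.VecField P 0) (msq a : ℝ)

/-- The sandwich `G^ε_lQ_l^*C^{(l)}Q_lG^ε_l` of (I.2.43) is symmetric for (I.1.5) (each factor is: `siteInner_propagatorK_comm`,
`siteInner_avgQkLin`, `siteInner_fluctCovA_comm`). [cite: Balaban1982Higgs1, (2.20) p.610, (2.43) p.612] -/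
theorem siteInner_sandwichR_comm (l : ℕ) (f g : ScalarField P 0 N) :
    siteInner f (sandwichR C Ω X msq a l g) = siteInner g (sandwichR C Ω X msq a l f) := by
  simp only [sandwichR, LinearMap.coe_comp, Function.comp_apply]
  rw [siteInner_propagatorK_comm, siteInner_comm, ← HiggsCovariancePos.siteInner_avgQkLin, siteInner_fluctCovA_comm,
    HiggsCovariancePos.siteInner_avgQkLin, siteInner_comm, siteInner_propagatorK_comm]

/-- **The scale pieces `G^η_{(j)}(Ω,X)` of (2.6) are symmetric** for (I.1.5): `⟨f, G^η_{(j)}g⟩ = ⟨g, G^η_{(j)}f⟩` (every `j`, every region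
and background). [cite: Balaban1983Higgs3, (2.6) p.424] [cite: Balaban1982Higgs1, (2.20) p.610, (2.43) p.612] -/
theorem siteInner_pieceR_comm (k j : ℕ) (f g : ScalarField P 0 N) :
    siteInner f (pieceR C Ω X msq a k j g) = siteInner g (pieceR C Ω X msq a k j f) := by
  unfold pieceR
  split_ifs
  · exact siteInner_propagatorK_comm C Ω X msq a 1 f g
  · rw [LinearMap.smul_apply, LinearMap.smul_apply, siteInner_smul_right, siteInner_smul_right, siteInner_sandwichR_comm]
  · simp [siteInner]

variable (Y : HiggsLattice.VecField P 0)

/-- **A piece on a dipole, by symmetry**: `⟨(G^η_{(j)}(Ω,X)dip^Y_bw)(x), v⟩ = ε⟨w, (D^ε_YG^η_{(j)}(Ω,X)δ_xv)(b)⟩` — the column slice of a piece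
on a dipole source (background `Y` of the dipole and the derivative, `X` of the piece) IS `ε`× the covariant derivative in the ROW variable
of the transposed slice (`siteInner_dip` + `siteInner_pieceR_comm`; r14's `inner_propagatorK_dip_apply` per piece).
[cite: Balaban1982Higgs1, (1.7) p.605, (2.20) p.610] [cite: Balaban1983Higgs3, (2.6) p.424] -/
theorem inner_pieceR_dip_apply (k j : ℕ) (b : HiggsLattice.PBond P 0) (w v : E N) (x : HiggsLattice.Site P 0) :
    ⟪pieceR C Ω X msq a k j (dip C Y b w) x, v⟫_ℝ
      = P.mesh 0 * ⟪w, covDeriv C Y (pieceR C Ω X msq a k j (Pi.single x v)) b⟫_ℝ := by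
  have h1 := siteInner_dip (C := C) (A := Y) b w (pieceR C Ω X msq a k j (Pi.single x v))
  rw [siteInner_pieceR_comm C Ω X msq a k j, siteInner_comm, siteInner_single_right] at h1
  exact mul_left_cancel₀ (pow_pos (P.mesh_pos 0) _).ne' h1

/-- `⟨z, z⟩ ≤ ‖z‖·c`, `c ≥ 0` ⟹ `‖z‖ ≤ c`. [folklore] -/
private theorem norm_le_of_inner_self_le' {z : E N} {c : ℝ} (hc : 0 ≤ c) (h : ⟪z, z⟫_ℝ ≤ ‖z‖ * c) : ‖z‖ ≤ c := by
  rw [real_inner_self_eq_norm_sq, pow_two] at h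
  by_cases hz0 : ‖z‖ = 0
  · rw [hz0]; exact hc
  · exact le_of_mul_le_mul_left h (lt_of_le_of_ne (norm_nonneg z) (Ne.symm hz0))

/-- **`‖(G^η_{(j)}(Ω,X)dip^Y_bw)(x)‖ ≤ ε‖w‖Σ_i‖(D^ε_YG^η_{(j)}(Ω,X)e_{(x,i)})(b)‖`** — the VALUE of a piece on a dipole is `ε`× ONE derivative of
the piece's row, read transposed (r14's `norm_propagatorK_dip_apply_le` per piece). [cite: Balaban1982Higgs1, (1.7) p.605, (2.20) p.610] [cite: Balaban1983Higgs3, (2.6) p.424, (2.10) p.426] -/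
theorem norm_pieceR_dip_apply_le (k j : ℕ) (b : HiggsLattice.PBond P 0) (w : E N) (x : HiggsLattice.Site P 0) :
    ‖pieceR C Ω X msq a k j (dip C Y b w) x‖
      ≤ P.mesh 0 * ‖w‖ * ∑ i : Ix N, ‖covDeriv C Y (pieceR C Ω X msq a k j (cb P N 0 (x, i))) b‖ := by
  have hS0 : 0 ≤ ∑ i : Ix N, ‖covDeriv C Y (pieceR C Ω X msq a k j (cb P N 0 (x, i))) b‖ :=
    Finset.sum_nonneg fun _ _ => norm_nonneg _
  have hε : 0 < P.mesh 0 := P.mesh_pos 0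
  refine norm_le_of_inner_self_le' (by positivity) ?_
  rw [inner_pieceR_dip_apply]
  calc P.mesh 0 * ⟪w, covDeriv C Y (pieceR C Ω X msq a k j (Pi.single x (pieceR C Ω X msq a k j (dip C Y b w) x))) b⟫_ℝ
      ≤ P.mesh 0 * (‖w‖ * ‖covDeriv C Y (pieceR C Ω X msq a k j (Pi.single x (pieceR C Ω X msq a k j (dip C Y b w) x))) b‖) :=
        mul_le_mul_of_nonneg_left (real_inner_le_norm _ _) hε.le
    _ ≤ P.mesh 0 * (‖w‖ * (‖pieceR C Ω X msq a k j (dip C Y b w) x‖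
          * ∑ i : Ix N, ‖covDeriv C Y (pieceR C Ω X msq a k j (cb P N 0 (x, i))) b‖)) :=
        mul_le_mul_of_nonneg_left (mul_le_mul_of_nonneg_left
          (B3Ineq210MixedRegularTorus.norm_covDeriv_apply_single_le C Y (pieceR C Ω X msq a k j) x _ b) (norm_nonneg _)) hε.le
    _ = _ := by ring

end PieceSymmetry

/-! ## §5 The pieces of `G_k(T_ε,X)` through one covariant derivative: columns, differentiated columns, twice-differentiated kernels -/

section PieceColumns

variable (C : ChargeData N) (msq a : ℝ) (k j : ℕ)

/-- **The column of the piece `G^η_{(j)}(T_ε,X)`**: `Σ_i‖(G^η_{(j)}e_{(y,i)})(x)‖` (= `ε^d·absG j x y` of r14's carrier). [cite: Balaban1983Higgs3, (2.6) p.424, (2.10) p.426] -/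
def pcol (X : HiggsLattice.VecField P 0) (x y : HiggsLattice.Site P 0) : ℝ :=
  ∑ i : Ix N, ‖pieceR C Finset.univ X msq a k j (cb P N 0 (y, i)) x‖

/-- **The differentiated column of the piece `G^η_{(j)}(T_ε,X)`**, derivative `D^ε_Y` at the bond `b` in the row variable:
`Σ_i‖(D^ε_YG^η_{(j)}e_{(y,i)})(b)‖`. [cite: Balaban1983Higgs3, (2.6) p.424, (2.10) p.426] -/
def pdcol (Y X : HiggsLattice.VecField P 0) (b : HiggsLattice.PBond P 0) (y : HiggsLattice.Site P 0) : ℝ :=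
  ∑ i : Ix N, ‖covDeriv C Y (pieceR C Finset.univ X msq a k j (cb P N 0 (y, i))) b‖

/-- **The twice-differentiated kernel of the piece `G^η_{(j)}(T_ε,X)`** (row derivative `D^ε_Y` at `b₀`, dipole `dip^Y` across `b`), with the
dipole's `ε⁻¹`: `ε⁻¹Σ_i‖(D^ε_YG^η_{(j)}dip^Y_be_i)(b₀)‖` (= `ε^d`× p33's `mixedTermR` for `Y = X`). [cite: Balaban1983Higgs3, (2.6) p.424, (2.10) p.426] -/
def pmix (Y X : HiggsLattice.VecField P 0) (b₀ b : HiggsLattice.PBond P 0) : ℝ :=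
  (P.mesh 0)⁻¹ * ∑ i : Ix N, ‖covDeriv C Y (pieceR C Finset.univ X msq a k j (dip C Y b (onb N i))) b₀‖

variable {C msq a k j}

/-- `pcol ≥ 0`. [cite: Balaban1983Higgs3, (2.10) p.426] -/
theorem pcol_nonneg (X : HiggsLattice.VecField P 0) (x y : HiggsLattice.Site P 0) : 0 ≤ pcol C msq a k j X x y :=
  Finset.sum_nonneg fun _ _ => norm_nonneg _

/-- `pdcol ≥ 0`. [cite: Balaban1983Higgs3, (2.10) p.426] -/
theorem pdcol_nonneg (Y X : HiggsLattice.VecField P 0) (b : HiggsLattice.PBond P 0) (y : HiggsLattice.Site P 0) :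
    0 ≤ pdcol C msq a k j Y X b y :=
  Finset.sum_nonneg fun _ _ => norm_nonneg _

/-- `pmix ≥ 0`. [cite: Balaban1983Higgs3, (2.10) p.426] -/
theorem pmix_nonneg (Y X : HiggsLattice.VecField P 0) (b₀ b : HiggsLattice.PBond P 0) : 0 ≤ pmix C msq a k j Y X b₀ b :=
  mul_nonneg (inv_nonneg.mpr (P.mesh_pos 0).le) (Finset.sum_nonneg fun _ _ => norm_nonneg _)

/-- `pmix` IS `ε^d`× p33's region quantity `mixedTermR` on `Ω = T_ε` (same pieces, same dipole). [cite: Balaban1983Higgs3, (2.6) p.424, (2.10) p.426] -/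
theorem pmix_eq_mixedTermR (X : HiggsLattice.VecField P 0) (b₀ b : HiggsLattice.PBond P 0) :
    pmix C msq a k j X X b₀ b
      = P.mesh 0 ^ P.d * B3Ineq210MixedRegularRegion.mixedTermR C Finset.univ X msq a k j b₀.dir b.dir b₀.src b.src := by
  unfold pmix B3Ineq210MixedRegularRegion.mixedTermR
  rw [← mul_assoc, mul_inv_cancel₀ (pow_pos (P.mesh_pos 0) _).ne', one_mul]

variable {hL1 : 1 < P.L} {K₀ : ℕ} {δ₁ Cst : ℝ} {X : HiggsLattice.VecField P 0}

/-- **(2.10) for one piece, value**: `pcol j X x y ≤ ε^dC(L^jε)^{2−d}e^{−δ₁(L^jε)^{−1}ε|x−y|}` from r15's carrier predicate on the torus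
(r14's `regRegionKernels … univ …`, every point interior). [cite: Balaban1983Higgs3, (2.10) p.426] -/
theorem pcol_le (h210 : (regRegionKernels hL1 C Finset.univ X msq a k K₀).Ineq210 δ₁ Cst) (x y : HiggsLattice.Site P 0) :
    pcol C msq a k j X x y ≤ (P.mesh 0 ^ P.d * Cst) * P.mesh j ^ ((2 : ℝ) - (P.d : ℝ)) *
        Real.exp (-(δ₁ * (P.mesh j)⁻¹ * (P.mesh 0 * (HiggsLattice.Site.tdist x y : ℝ)))) := by
  have hm : 0 < P.mesh 0 ^ P.d := pow_pos (P.mesh_pos 0) _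
  have h := (h210 j ⟨x, interior_univ x⟩ ⟨y, interior_univ y⟩).1
  have e1 : (regRegionKernels hL1 C Finset.univ X msq a k K₀).absG j ⟨x, interior_univ x⟩ ⟨y, interior_univ y⟩
      = (P.mesh 0 ^ P.d)⁻¹ * pcol C msq a k j X x y := rfl
  have e3 : (regRegionKernels hL1 C Finset.univ X msq a k K₀).dist ⟨x, interior_univ x⟩ ⟨y, interior_univ y⟩
      = P.mesh 0 * (HiggsLattice.Site.tdist x y : ℝ) := rfl
  have e4 : (regRegionKernels hL1 C Finset.univ X msq a k K₀).d = P.d := rfl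
  rw [scaleR_eq, e1, e3, e4, inv_mul_le_iff₀ hm] at h
  refine h.trans (le_of_eq ?_)
  ring

/-- **(2.10) for one piece, one derivative** (in the piece's own background): `pdcol j X X b y ≤ ε^dC(L^jε)^{1−d}e^{−δ₁(L^jε)^{−1}ε|b₋−y|}`.
[cite: Balaban1983Higgs3, (2.10) p.426] -/
theorem pdcol_le (h210 : (regRegionKernels hL1 C Finset.univ X msq a k K₀).Ineq210 δ₁ Cst) (b : HiggsLattice.PBond P 0)
    (y : HiggsLattice.Site P 0) :
    pdcol C msq a k j X X b y ≤ (P.mesh 0 ^ P.d * Cst) * P.mesh j ^ ((1 : ℝ) - (P.d : ℝ)) *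
        Real.exp (-(δ₁ * (P.mesh j)⁻¹ * (P.mesh 0 * (HiggsLattice.Site.tdist b.src y : ℝ)))) := by
  have hm : 0 < P.mesh 0 ^ P.d := pow_pos (P.mesh_pos 0) _
  have h := (h210 j ⟨b.src, interior_univ b.src⟩ ⟨y, interior_univ y⟩).2 b.dir
  have e2 : (regRegionKernels hL1 C Finset.univ X msq a k K₀).absDG j b.dir ⟨b.src, interior_univ b.src⟩ ⟨y, interior_univ y⟩
      = (P.mesh 0 ^ P.d)⁻¹ * pdcol C msq a k j X X b y := rfl
  have e3 : (regRegionKernels hL1 C Finset.univ X msq a k K₀).dist ⟨b.src, interior_univ b.src⟩ ⟨y, interior_univ y⟩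
      = P.mesh 0 * (HiggsLattice.Site.tdist b.src y : ℝ) := rfl
  have e4 : (regRegionKernels hL1 C Finset.univ X msq a k K₀).d = P.d := rfl
  rw [scaleR_eq, e2, e3, e4, inv_mul_le_iff₀ hm] at h
  refine h.trans (le_of_eq ?_)
  ring

variable {CM : ℝ}

/-- **(2.10) for one piece, twice differentiated** (row derivative and dipole in the piece's own background), in the majorant currency:
`pmix j X X b₀ b ≤ ε^dC_M(L^jε)^{0−d}e^{−δ₁(L^jε)^{−1}ε|b₀₋−b₋|}` from a bound of p33's `mixedTermR` on `T_ε` in the shape of the conclusion of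
`B3Ineq210MixedRegularRegion.ineq210_mixed_regularRegion_univ`. [cite: Balaban1983Higgs3, (2.10) p.426] -/
theorem pmix_le
    (hmix : ∀ (j : ℕ) (μ ν : Fin P.d) (x x' : HiggsLattice.Site P 0),
      B3Ineq210MixedRegularRegion.mixedTermR C Finset.univ X msq a k j μ ν x x'
        ≤ CM * (P.mesh j ^ P.d)⁻¹ * Real.exp (-(δ₁ * ((HiggsLattice.Site.tdist x x' : ℝ) / (P.L : ℝ) ^ j))))
    (b₀ b : HiggsLattice.PBond P 0) :
    pmix C msq a k j X X b₀ b ≤ (P.mesh 0 ^ P.d * CM) * P.mesh j ^ ((0 : ℝ) - (P.d : ℝ)) *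
        Real.exp (-(δ₁ * (P.mesh j)⁻¹ * (P.mesh 0 * (HiggsLattice.Site.tdist b₀.src b.src : ℝ)))) := by
  rw [pmix_eq_mixedTermR, mesh_rpow_zero_sub, rate_eq, div_mul_eq_mul_div]
  have h := hmix j b₀.dir b.dir b₀.src b.src
  calc P.mesh 0 ^ P.d * B3Ineq210MixedRegularRegion.mixedTermR C Finset.univ X msq a k j b₀.dir b.dir b₀.src b.src
      ≤ P.mesh 0 ^ P.d * (CM * (P.mesh j ^ P.d)⁻¹ *
          Real.exp (-(δ₁ * ((HiggsLattice.Site.tdist b₀.src b.src : ℝ) / (P.L : ℝ) ^ j)))) :=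
        mul_le_mul_of_nonneg_left h (pow_nonneg (P.mesh_pos 0).le _)
    _ = _ := by rw [mul_div_assoc]; ring

variable (C msq a k)

/-- **(2.6) through one covariant derivative**: `(D^ε_YG_k(T_ε,X)f)(b) = Σ_{j<k}(D^ε_YG^η_{(j)}f)(b)` (`sum_pieceR`, linearity of `D^ε_Y`).
[cite: Balaban1983Higgs3, (2.6) p.424] -/
theorem covDeriv_propagatorK_eq_sum_pieces (Y X : HiggsLattice.VecField P 0) (hmsq : 0 < msq) (ha : 0 < a) (hL1 : 1 < P.L)
    (hk : 1 ≤ k) (hkK : k ≤ P.K) (f : ScalarField P 0 N) (b : HiggsLattice.PBond P 0) :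
    covDeriv C Y (propagatorK C Finset.univ X msq a k f) b
      = ∑ j ∈ Finset.range k, covDeriv C Y (pieceR C Finset.univ X msq a k j f) b := by
  rw [← sum_pieceR (C := C) (Ω := Finset.univ) (A := X) (a := a) hmsq ha hL1 hk hkK, LinearMap.sum_apply,
    B3Ineq210RegularTorus.covDeriv_sum'']

/-- **(2.6) on a field**: `G_k(T_ε,X)f = Σ_{j<k}G^η_{(j)}f`. [cite: Balaban1983Higgs3, (2.6) p.424] -/
theorem propagatorK_apply_eq_sum_pieces (X : HiggsLattice.VecField P 0) (hmsq : 0 < msq) (ha : 0 < a) (hL1 : 1 < P.L)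
    (hk : 1 ≤ k) (hkK : k ≤ P.K) (f : ScalarField P 0 N) :
    propagatorK C Finset.univ X msq a k f = ∑ j ∈ Finset.range k, pieceR C Finset.univ X msq a k j f := by
  rw [← sum_pieceR (C := C) (Ω := Finset.univ) (A := X) (a := a) hmsq ha hL1 hk hkK, LinearMap.sum_apply]

end PieceColumns

/-! ## §6 Block averages of a majorant of any positive exponent: a single top-scale bump (the averaging sources of THEOREM A) -/

section Blocks

open HiggsAveraging (blockIter blockK)

/-- `(L^kε)^e·((L^kε)^d)^{−1} = (L^kε)^{e−d}`. [cite: Balaban1983Higgs3, (2.10) p.426] -/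
theorem mesh_rpow_mul_inv_pow_eq (k : ℕ) (e : ℝ) : P.mesh k ^ e * (P.mesh k ^ P.d)⁻¹ = P.mesh k ^ (e - (P.d : ℝ)) := by
  rw [Real.rpow_sub (P.mesh_pos k), Real.rpow_natCast, div_eq_mul_inv]

variable {k : ℕ}

/-- **THE BLOCK AVERAGE OF A MAJORANT IS A SINGLE TOP-SCALE BUMP** (`1 ≤ k ≤ K`, `0 < δ ≤ 1`, exponent `e > 0`): if
`W(y) ≤ Σ_{j<k} c(L^jε)^{e−d}exp(−δ(L^jε)^{−1}ε|y−x′|)` on the `L^k`-block of `z`, then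
`L^{−kd}Σ_{y∈B^k(z̄)}W(y) ≤ [e^{δ/2}N(8d/δ)^d/(L^e−1)]·c·(L^kε)^e((L^kε)^d)^{−1}·exp(−(δ/2)(L^kε)^{−1}ε|z−x′|)` — r14's `block_avg_col_le`
(the case `e = 2`, `W = κ_X`) for any exponent (`sum_block_exp_le`, `sum_mesh_rpow_le`). [cite: Balaban1982Higgs1, (1.20) p.607, (3.15) p.614] [cite: Balaban1983Higgs3, (2.10) p.426] -/
theorem block_avg_majorant_le (hL1 : 1 < P.L) (hk : 1 ≤ k) (hkK : k ≤ P.K) {δ c e : ℝ} (hδ : 0 < δ) (hδ1 : δ ≤ 1) (hc : 0 ≤ c)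
    (he : 0 < e) (i₀ : Ix N) (W : HiggsLattice.Site P 0 → ℝ) (z x' : HiggsLattice.Site P 0)
    (hW : ∀ y ∈ blockK k (blockIter k z), W y ≤ ∑ j ∈ Finset.range k, c * P.mesh j ^ (e - (P.d : ℝ)) *
      Real.exp (-(δ * (P.mesh j)⁻¹ * (P.mesh 0 * (HiggsLattice.Site.tdist y x' : ℝ))))) :
    ((P.L : ℝ) ^ (k * P.d))⁻¹ * ∑ y ∈ blockK k (blockIter k z), W y
      ≤ (Real.exp (δ / 2) * ((nCol N : ℝ) * (4 * P.d / (δ / 2)) ^ P.d) / ((P.L : ℝ) ^ e - 1)) * c *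
          (P.mesh k ^ e * (P.mesh k ^ P.d)⁻¹) *
          Real.exp (-(δ / 2 * (P.mesh k)⁻¹ * (P.mesh 0 * (HiggsLattice.Site.tdist z x' : ℝ)))) := by
  have _ := hk
  have hLk0 : (0 : ℝ) < ((P.L : ℝ) ^ (k * P.d))⁻¹ := by positivity
  set E : ℝ := Real.exp (-(δ / 2 * (P.mesh k)⁻¹ * (P.mesh 0 * (HiggsLattice.Site.tdist z x' : ℝ)))) with hE
  set Kb : ℝ := Real.exp (δ / 2) * ((nCol N : ℝ) * (4 * P.d / (δ / 2)) ^ P.d) with hKb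
  have hKb0 : 0 ≤ Kb := by
    have : 0 ≤ (4 * (P.d : ℝ) / (δ / 2)) ^ P.d := pow_nonneg (by positivity) _
    rw [hKb]; positivity
  -- step 1: the majorants, sums exchanged
  have step1 : ∑ y ∈ blockK k (blockIter k z), W y
      ≤ ∑ j ∈ Finset.range k, c * P.mesh j ^ (e - (P.d : ℝ)) *
          ∑ y ∈ blockK k (blockIter k z), Real.exp (-(δ / (P.L : ℝ) ^ j * (HiggsLattice.Site.tdist y x' : ℝ))) := by
    calc ∑ y ∈ blockK k (blockIter k z), W y
        ≤ ∑ y ∈ blockK k (blockIter k z), ∑ j ∈ Finset.range k, c * P.mesh j ^ (e - (P.d : ℝ)) *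
              Real.exp (-(δ / (P.L : ℝ) ^ j * (HiggsLattice.Site.tdist y x' : ℝ))) := by
          refine Finset.sum_le_sum fun y hy => (hW y hy).trans (le_of_eq ?_)
          simp only [rate_eq]
      _ = _ := by rw [Finset.sum_comm]; simp_rw [Finset.mul_sum]
  -- step 2: each block sum
  have step2 : ∀ j ∈ Finset.range k,
      c * P.mesh j ^ (e - (P.d : ℝ)) *
          ∑ y ∈ blockK k (blockIter k z), Real.exp (-(δ / (P.L : ℝ) ^ j * (HiggsLattice.Site.tdist y x' : ℝ)))
        ≤ c * Kb * E * (P.mesh j ^ (e - (P.d : ℝ)) * ((P.L : ℝ) ^ j) ^ P.d) := by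
    intro j hj
    have hjk : j ≤ k := (Finset.mem_range.1 hj).le
    have hb := B3Op116KernelRegularTorus.sum_block_exp_le (N := N) hkK hδ hδ1 hjk z x' i₀
    have hE' : Real.exp (-(δ / 2 / (P.L : ℝ) ^ k * (HiggsLattice.Site.tdist z x' : ℝ))) = E := by
      rw [hE, ← rate_eq]
    rw [hE'] at hb
    have hℓ : 0 ≤ c * P.mesh j ^ (e - (P.d : ℝ)) := mul_nonneg hc (Real.rpow_nonneg (P.mesh_pos j).le _)
    refine (mul_le_mul_of_nonneg_left hb hℓ).trans (le_of_eq ?_)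
    rw [hKb]; ring
  -- step 3: the scale sum
  have step3 : ∑ j ∈ Finset.range k, P.mesh j ^ (e - (P.d : ℝ)) * ((P.L : ℝ) ^ j) ^ P.d * ((P.L : ℝ) ^ (k * P.d))⁻¹
      ≤ P.mesh k ^ e / ((P.L : ℝ) ^ e - 1) * (P.mesh k ^ P.d)⁻¹ := by
    simp_rw [B3Op116MajorantStep.blockavg_scale_algebra']
    rw [← Finset.sum_mul]
    exact mul_le_mul_of_nonneg_right (B3Op116ScaleChains.sum_mesh_rpow_le he hL1 k) (inv_nonneg.mpr (pow_nonneg (P.mesh_pos k).le _))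
  -- assemble
  calc ((P.L : ℝ) ^ (k * P.d))⁻¹ * ∑ y ∈ blockK k (blockIter k z), W y
      ≤ ((P.L : ℝ) ^ (k * P.d))⁻¹ * ∑ j ∈ Finset.range k, c * Kb * E * (P.mesh j ^ (e - (P.d : ℝ)) * ((P.L : ℝ) ^ j) ^ P.d) :=
        mul_le_mul_of_nonneg_left (step1.trans (Finset.sum_le_sum step2)) hLk0.le
    _ = c * Kb * E * ∑ j ∈ Finset.range k, P.mesh j ^ (e - (P.d : ℝ)) * ((P.L : ℝ) ^ j) ^ P.d * ((P.L : ℝ) ^ (k * P.d))⁻¹ := by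
        rw [Finset.mul_sum, Finset.mul_sum]
        exact Finset.sum_congr rfl fun j _ => by ring
    _ ≤ c * Kb * E * (P.mesh k ^ e / ((P.L : ℝ) ^ e - 1) * (P.mesh k ^ P.d)⁻¹) :=
        mul_le_mul_of_nonneg_left step3 (mul_nonneg (mul_nonneg hc hKb0) (Real.exp_nonneg _))
    _ = _ := by rw [hKb]; ring

end Blocks

end Literature.MathematicalPhysics.QuantumFieldTheory.Balaban1983to89.B3Op116OrderedPairs

end
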